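import Summits.CriticalPhenomena.PercolationContinuityZ3.Theorems.PercNearOneGluingNoHeavyQuantFarSunCfgProducts2
import HarnessLib

/-!
# FAR beyond trees: the Kronecker checker with SHARED PRODUCTS for per-`K` configuration-level certificates (`HairyCycle.SunFAR K j`)

builds on p205010 (kernel theorem, internal audit signed; external expert review pending)

Support file (`--supports stmt-CriticalPhenomena-4575`), seat `prim-cert-1` (gen 26); memo `prim-cert-1/FROM-prim-cert-1-g26-CONFIG-CERTS.md` §7.
Same soundness route as `…QuantFarSunCfgKron` (gen 18's `TwoCopy.twoCopyKronCheck` on precomputed records ⇒ `TwoCopy.twoCopyCheck` ⇒ fibre sums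
`≥ 0` ⇒ `TK.sunFAR_of_fib`), but on the shareable decomposition `TK.blockTerms2` (`…QuantFarSunCfgProducts2`): the Kronecker PRODUCTS of the
indicator terms depend on (ghost extent, `k`) only and are computed once per prefix length `l` (ghost `(l, ·)`) resp. once per `m` (ghost `(m, ·)`),
so a block costs `4` big multiplications instead of `4K+10` (≈ `K×` faster at `K ≥ 9`).
* `TK.PRec`, `TK.mkP`, `TK.kronPreP`, `TK.kronCheck_of_kronPreP` — product records and the check on them;
* `TK.SBanks`, `TK.mkSBanks`, `TK.mkPKl`, `TK.mkPKm`, `TK.blockRecs2` (+ `_t`, `_a`, `_ok`) — shared records and products;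
* `TK.kronL2` (shard = prefix length `l`), `TK.kronAll2`;  `TK.fib_nonneg_of_kronL2`;
* **`TK.sunFAR_of_kronL2`** / **`TK.sunFAR_of_kron2`** — normalisation check + all shards (resp. `kronAll2`) `= true` ⇒ `SunFAR K j`;
* `TK.PrefixInv` (readers blind to ghost prefix length `K` vs `K+1`: `prefixInv_cy532`, `prefixInv_rl`), `TK.Gm_succ_self`, **`TK.sunFAR_of_kronL2'`** —
  the shards `l ≤ K` suffice (the `l = K+1` blocks duplicate the `l = K` blocks), saving `(K+2)/Σ(l+1) ≈ 15 %`.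
No sorries; standard axioms; nothing here asserts anything about a particular certificate.  Elementary [this work].
-/

namespace Summit.CriticalPhenomena.PercolationContinuityZ3.Theorems.HairyCycle

namespace TK

open Finset
open Summit.CriticalPhenomena.PercolationContinuityZ3.Theorems.TwoCopy (fib pairing twoCopyCheck twoCopyKronCheck
  twoCopyCheck_of_kronCheck fib_nonneg_of_check)
open Summit.CriticalPhenomena.PercolationContinuityZ3.Theorems.OneCutCert (krN krZ maxNat maxAbs)

variable {K : ℕ}

/-! ## Product records -/

/-- A product record: an integer table record, a natural table record, their Kronecker product and the product of their maxima. [this work] -/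
structure PRec where
  /-- `t`-side record -/
  t : KRec
  /-- `a`-side record -/
  a : NRec
  /-- `a.kr * t.kr` -/
  pr : ℤ
  /-- `a.mx * t.mx` -/
  mx : ℕ

/-- The product record of two table records (one big multiplication). [this work] -/
def mkP (t : KRec) (a : NRec) : PRec := ⟨t, a, (a.kr : ℤ) * t.kr, a.mx * t.mx⟩

/-- A default product record (for out-of-range lookups). [this work] -/
def PRec.dflt : PRec := ⟨⟨[], 0, 0⟩, ⟨[], 0, 0⟩, 0, 0⟩

/-- Faithful product records. [this work] -/
structure PRecOK (s m : ℕ) (p : PRec) : Prop where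
  /-- the two table records are faithful -/
  tabs : RecOK s m (p.t, p.a)
  /-- the product field -/
  pr : p.pr = (p.a.kr : ℤ) * p.t.kr
  /-- the max field -/
  mx : p.mx = p.a.mx * p.t.mx

/-- `mkP` of records made by `mkK`, `mkN` is faithful. [this work] -/
theorem precOK_mkP (s m : ℕ) (f : ℕ → ℤ) (g : ℕ → ℕ) : PRecOK s m (mkP (mkK s m f) (mkN s m g)) :=
  ⟨recOK_mk s m f g, rfl, rfl⟩

/-- `TwoCopy.twoCopyKronCheck` computed from product records (no multiplication inside). [this work] -/
def kronPreP (m s : ℕ) (R : List PRec) (hL : List ℤ) (bL : List ℕ) : Bool :=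
  let Z : ℤ := (R.map fun r => r.pr).sum - (krN s m bL : ℤ) * krZ s m hL
  let off : ℤ := 2 ^ (s - 1) * (((2 : ℤ) ^ (s * 3 ^ m) - 1) / (2 ^ s - 1))
  let bnd : ℕ := 2 ^ m * ((R.map fun r => r.mx).sum + maxNat bL * maxAbs hL)
  decide (0 < s) && (R.all fun r => r.t.tab.length = 2 ^ m) && decide (hL.length = 2 ^ m)
    && (R.all fun r => r.a.tab.length = 2 ^ m) && decide (bL.length = 2 ^ m)
    && decide (bnd < 2 ^ (s - 1))
    && decide (0 ≤ Z + off) && decide (((Z + off).toNat &&& off.toNat) = off.toNat)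

/-- **A passed `kronPreP` on faithful product records is a passed `twoCopyKronCheck` on the underlying tables.** [this work] -/
theorem kronCheck_of_kronPreP {m s : ℕ} {R : List PRec} {hL : List ℤ} {bL : List ℕ} (hR : ∀ r ∈ R, PRecOK s m r)
    (h : kronPreP m s R hL bL = true) :
    twoCopyKronCheck m R.length s (R.map fun r => r.t.tab) hL (R.map fun r => r.a.tab) bL = true := by
  have h' : kronPre m s (R.map fun r => (r.t, r.a)) hL bL = true := by
    unfold kronPreP at h
    unfold kronPre
    simp only [Bool.and_eq_true, decide_eq_true_eq, List.all_eq_true, List.mem_map] at h ⊢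
    obtain ⟨⟨⟨⟨⟨⟨⟨hs, ht⟩, hhlen⟩, ha⟩, hblen⟩, hbnd⟩, hZoff⟩, hland⟩ := h
    have eZ : ((R.map fun r => (r.t, r.a)).map fun r => (r.2.kr : ℤ) * r.1.kr).sum = (R.map fun r => r.pr).sum := by
      rw [List.map_map]
      congr 1
      exact List.map_congr_left fun r hr => ((hR r hr).pr).symm
    have eB : ((R.map fun r => (r.t, r.a)).map fun r => r.2.mx * r.1.mx).sum = (R.map fun r => r.mx).sum := by
      rw [List.map_map]
      congr 1
      exact List.map_congr_left fun r hr => ((hR r hr).mx).symm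
    rw [eZ, eB]
    refine ⟨⟨⟨⟨⟨⟨⟨hs, ?_⟩, hhlen⟩, ?_⟩, hblen⟩, hbnd⟩, hZoff⟩, hland⟩
    · rintro r ⟨p, hp, rfl⟩; exact ht p hp
    · rintro r ⟨p, hp, rfl⟩; exact ha p hp
  have hk := kronCheck_of_kronPre (R := R.map fun r => (r.t, r.a)) (fun r hr => by
    obtain ⟨p, hp, rfl⟩ := List.mem_map.1 hr
    exact (hR p hp).tabs) h'
  rw [List.length_map, List.map_map, List.map_map] at hk
  exact hk

/-! ## Shared banks -/

/-- Static record banks: indicator tables `IT[k]`, `IA[k]`, the all-ones tables, ghost-side tables by extent `(g, g')`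
(`GQ, GS, GK` natural; `HQ, HS, HK` integer), threshold tables by extent `(l, u)` (`TJ` integer, `AJ` natural), and the
all-ones products `PQ[g][g']`, `PQ'[g][g']`. [this work] -/
structure SBanks where
  /-- `−𝟙[bit k]` -/
  IT : Array KRec
  /-- `𝟙[bit k]` -/
  IA : Array NRec
  /-- `Σa` by ghost extent -/
  GS : Array (Array NRec)
  /-- `a_k + b` by ghost extent and `k` -/
  GK : Array (Array (Array NRec))
  /-- `−Σa` by ghost extent -/
  HS : Array (Array KRec)
  /-- `−(a_k + b)` by ghost extent and `k` -/
  HK : Array (Array (Array KRec))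
  /-- `−𝟙[pc ≤ j]` by copy extent -/
  TJ : Array (Array KRec)
  /-- `𝟙[pc ≤ j]` by copy extent -/
  AJ : Array (Array NRec)
  /-- `1 · (Σa + 2jb)` products by ghost extent -/
  PQ : Array (Array PRec)
  /-- `(Σa + 2jb) · 1` products by ghost extent -/
  PQ' : Array (Array PRec)

/-- Building the static banks. [this work] -/
def mkSBanks (K j s : ℕ) (t : NTabs) : SBanks where
  IT := Array.ofFn fun k : Fin K => mkK s K (ftI k)
  IA := Array.ofFn fun k : Fin K => mkN s K (baI k)
  GS := Array.ofFn fun g : Fin (K + 2) => Array.ofFn fun g' : Fin (K + 1) => mkN s K (fsA t g g')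
  GK := Array.ofFn fun g : Fin (K + 2) => Array.ofFn fun g' : Fin (K + 1) => Array.ofFn fun k : Fin K => mkN s K (fgA t g g' k)
  HS := Array.ofFn fun g : Fin (K + 2) => Array.ofFn fun g' : Fin (K + 1) => mkK s K (bsT t g g')
  HK := Array.ofFn fun g : Fin (K + 2) => Array.ofFn fun g' : Fin (K + 1) => Array.ofFn fun k : Fin K => mkK s K (bgT t g g' k)
  TJ := Array.ofFn fun l : Fin (K + 2) => Array.ofFn fun u : Fin (K + 1) => mkK s K (ftJ j (covM K l u))
  AJ := Array.ofFn fun l : Fin (K + 2) => Array.ofFn fun u : Fin (K + 1) => mkN s K (baJ j (covM K l u))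
  PQ := Array.ofFn fun g : Fin (K + 2) => Array.ofFn fun g' : Fin (K + 1) => mkP (mkK s K fun _ => 1) (mkN s K (fqA j t g g'))
  PQ' := Array.ofFn fun g : Fin (K + 2) => Array.ofFn fun g' : Fin (K + 1) => mkP (mkK s K (bqT j t g g')) (mkN s K fun _ => 1)

/-- Products of the backward indicator terms for the ghost extents `(l, ·)`: `[u][k] = (−(a_k+b) at (l,u)) · 𝟙[bit k]`. [this work] -/
def mkPKl (K : ℕ) (SB : SBanks) (l : ℕ) : Array (Array PRec) :=
  Array.ofFn fun u : Fin (K + 1) => Array.ofFn fun k : Fin K =>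
    mkP ((((SB.HK.getD l #[]).getD u #[]).getD k ⟨[], 0, 0⟩)) (SB.IA.getD k ⟨[], 0, 0⟩)

/-- Products of the forward indicator terms for the ghost extents `(m, ·)`: `[v][k] = (−𝟙[bit k]) · (a_k+b at (m,v))`. [this work] -/
def mkPKm (K : ℕ) (SB : SBanks) (m : ℕ) : Array (Array PRec) :=
  Array.ofFn fun v : Fin (K + 1) => Array.ofFn fun k : Fin K =>
    mkP (SB.IT.getD k ⟨[], 0, 0⟩) (((SB.GK.getD m #[]).getD v #[]).getD k ⟨[], 0, 0⟩)

/-- The product records of the block `(l, m, u, v)` (aligned with `TK.blockTerms2`): per direction the all-ones product, the threshold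
product (the only multiplication done here) and the shared indicator products for `k ∈` the coverage mask. [this work] -/
def blockRecs2 (K s : ℕ) (SB : SBanks) (PKl PKm : Array (Array PRec)) (l m u v : ℕ) : List PRec :=
  let fw := fun (M g' : ℕ) (PK : Array (Array PRec)) (lT : ℕ) (uT : ℕ) =>
    ((SB.PQ.getD m #[]).getD g' PRec.dflt) ::
      mkP (((SB.TJ.getD lT #[]).getD uT ⟨[], 0, 0⟩)) (((SB.GS.getD m #[]).getD g' ⟨[], 0, 0⟩)) ::
        (bits K M).map fun k => (PK.getD g' #[]).getD k PRec.dflt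
  let bw := fun (M' g' : ℕ) (PK : Array (Array PRec)) (mA : ℕ) (vA : ℕ) =>
    ((SB.PQ'.getD l #[]).getD g' PRec.dflt) ::
      mkP (((SB.HS.getD l #[]).getD g' ⟨[], 0, 0⟩)) (((SB.AJ.getD mA #[]).getD vA ⟨[], 0, 0⟩)) ::
        (bits K M').map fun k => (PK.getD g' #[]).getD k PRec.dflt
  let _ := s
  fw (covM K l u) v PKm l u ++ bw (covM K m v) u PKl m v ++ (fw (covM K l v) u PKm l v ++ bw (covM K m u) v PKl m u)

variable {am : ℕ → ℕ → ℕ → ℕ → ℕ} {bm : ℕ → ℕ → ℕ → ℕ} {j s : ℕ}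

/-- Members of `bits K M` are `< K`. [this work] -/
theorem lt_of_mem_bits {K M k : ℕ} (h : k ∈ bits K M) : k < K := by
  unfold bits at h
  exact List.mem_range.1 (List.mem_filter.1 h).1

/-- The block records, unfolded (all lookups in range). [this work] -/
theorem blockRecs2_mk {l m u v : ℕ} (hl : l < K + 2) (hm : m < K + 2) (hu : u < K + 1) (hv : v < K + 1) (t : NTabs) :
    blockRecs2 K s (mkSBanks K j s t) (mkPKl K (mkSBanks K j s t) l) (mkPKm K (mkSBanks K j s t) m) l m u v =
      (mkP (mkK s K fun _ => 1) (mkN s K (fqA j t m v)) :: mkP (mkK s K (ftJ j (covM K l u))) (mkN s K (fsA t m v)) ::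
          (bits K (covM K l u)).map fun k => mkP (mkK s K (ftI k)) (mkN s K (fgA t m v k))) ++
      (mkP (mkK s K (bqT j t l u)) (mkN s K fun _ => 1) :: mkP (mkK s K (bsT t l u)) (mkN s K (baJ j (covM K m v))) ::
          (bits K (covM K m v)).map fun k => mkP (mkK s K (bgT t l u k)) (mkN s K (baI k))) ++
      ((mkP (mkK s K fun _ => 1) (mkN s K (fqA j t m u)) :: mkP (mkK s K (ftJ j (covM K l v))) (mkN s K (fsA t m u)) ::
          (bits K (covM K l v)).map fun k => mkP (mkK s K (ftI k)) (mkN s K (fgA t m u k))) ++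
        (mkP (mkK s K (bqT j t l v)) (mkN s K fun _ => 1) :: mkP (mkK s K (bsT t l v)) (mkN s K (baJ j (covM K m u))) ::
          (bits K (covM K m u)).map fun k => mkP (mkK s K (bgT t l v k)) (mkN s K (baI k)))) := by
  unfold blockRecs2 mkPKl mkPKm mkSBanks
  simp only [getD_ofFn _ _ hl, getD_ofFn _ _ hm, getD_ofFn _ _ hu, getD_ofFn _ _ hv]
  have e : ∀ (M : ℕ) (F G : ℕ → PRec), (∀ k, k < K → F k = G k) → (bits K M).map F = (bits K M).map G :=
    fun M F G h => List.map_congr_left fun k hk => h k (lt_of_mem_bits hk)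
  refine congrArg₂ _ (congrArg₂ _ (congrArg _ (congrArg _ (e _ _ _ fun k hk => ?_)))
    (congrArg _ (congrArg _ (e _ _ _ fun k hk => ?_))))
    (congrArg₂ _ (congrArg _ (congrArg _ (e _ _ _ fun k hk => ?_))) (congrArg _ (congrArg _ (e _ _ _ fun k hk => ?_)))) <;>
  simp only [getD_ofFn _ _ hk]

/-- `t`-tables of the block records = tabulated `t`-factors of `blockTerms2`. [this work] -/
theorem blockRecs2_t {l m u v : ℕ} (hl : l < K + 2) (hm : m < K + 2) (hu : u < K + 1) (hv : v < K + 1) (t : NTabs) :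
    (blockRecs2 K s (mkSBanks K j s t) (mkPKl K (mkSBanks K j s t) l) (mkPKm K (mkSBanks K j s t) m) l m u v).map (fun r => r.t.tab) =
      (blockTerms2 K j t l m u v).map fun x => tabulate (2 ^ K) x.1 := by
  rw [blockRecs2_mk hl hm hu hv]
  unfold blockTerms2 fwd2 bwd2
  simp only [List.map_append, List.map_cons, List.map_map]
  rfl

/-- `a`-tables of the block records = tabulated `a`-factors of `blockTerms2`. [this work] -/
theorem blockRecs2_a {l m u v : ℕ} (hl : l < K + 2) (hm : m < K + 2) (hu : u < K + 1) (hv : v < K + 1) (t : NTabs) :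
    (blockRecs2 K s (mkSBanks K j s t) (mkPKl K (mkSBanks K j s t) l) (mkPKm K (mkSBanks K j s t) m) l m u v).map (fun r => r.a.tab) =
      (blockTerms2 K j t l m u v).map fun x => tabulate (2 ^ K) x.2 := by
  rw [blockRecs2_mk hl hm hu hv]
  unfold blockTerms2 fwd2 bwd2
  simp only [List.map_append, List.map_cons, List.map_map]
  rfl

/-- The block records are faithful. [this work] -/
theorem blockRecs2_ok {l m u v : ℕ} (hl : l < K + 2) (hm : m < K + 2) (hu : u < K + 1) (hv : v < K + 1) (t : NTabs) :
    ∀ r ∈ blockRecs2 K s (mkSBanks K j s t) (mkPKl K (mkSBanks K j s t) l) (mkPKm K (mkSBanks K j s t) m) l m u v, PRecOK s K r := by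
  rw [blockRecs2_mk hl hm hu hv]
  intro r hr
  simp only [List.mem_append, List.mem_cons, List.mem_map] at hr
  rcases hr with ((rfl | rfl | ⟨k, -, rfl⟩) | (rfl | rfl | ⟨k, -, rfl⟩)) | ((rfl | rfl | ⟨k, -, rfl⟩) | (rfl | rfl | ⟨k, -, rfl⟩)) <;>
    exact precOK_mkP s K _ _

/-! ## The checker -/

/-- THE SHARED KRONECKER CHECK of the blocks with prefix length `l` — the unit of sharding.  The indicator products of the ghost extents
`(l, ·)` are built once, those of `(m, ·)` once per `m`; a block then costs `4` multiplications. [this work] -/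
def kronL2 (K s : ℕ) (SB : SBanks) (l : ℕ) : Bool :=
  let PKl := mkPKl K SB l
  (List.range (l + 1)).all fun m =>
    let PKm := mkPKm K SB m
    (List.range (K + 1)).all fun v => (List.range (v + 1)).all fun u =>
      kronPreP K s (blockRecs2 K s SB PKl PKm l m u v) (List.replicate (2 ^ K) 0) (List.replicate (2 ^ K) 0)

/-- THE SHARED KRONECKER CHECK of all blocks. [this work] -/
def kronAll2 (K j s : ℕ) (am : ℕ → ℕ → ℕ → ℕ → ℕ) (bm : ℕ → ℕ → ℕ → ℕ) : Bool :=
  let SB := mkSBanks K j s (mkNTabs K am bm)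
  (List.range (K + 2)).all fun l => kronL2 K s SB l

/-! ## Soundness -/

/-- **Soundness of the shared Kronecker check**: every fibre sum of every block pair function is nonnegative. [this work] -/
theorem fib_nonneg_of_kronL2 (h : ∀ l, l < K + 2 → kronL2 K s (mkSBanks K j s (mkNTabs K am bm)) l = true) :
    ∀ l m u v : ℕ, m ≤ l → l ≤ K + 1 → u ≤ v → v ≤ K →
      ∀ z t : ℕ, z < 2 ^ K → t < 2 ^ K → z &&& t = 0 → 0 ≤ fib K (Gm K j am bm l m u v) z t := by
  intro l m u v hml hl huv hv z t hz ht hzt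
  have h1 := h l (by omega)
  unfold kronL2 at h1
  simp only [List.all_eq_true, List.mem_range] at h1
  have hb := h1 m (by omega) v (by omega) u (by omega)
  have hk := kronCheck_of_kronPreP (blockRecs2_ok (j := j) (s := s) (by omega) (by omega) (by omega) (by omega) (mkNTabs K am bm)) hb
  have hlen : (blockRecs2 K s (mkSBanks K j s (mkNTabs K am bm)) (mkPKl K (mkSBanks K j s (mkNTabs K am bm)) l)
      (mkPKm K (mkSBanks K j s (mkNTabs K am bm)) m) l m u v).length = (blockTerms2 K j (mkNTabs K am bm) l m u v).length := by
    rw [← List.length_map (f := fun r : PRec => r.t.tab), blockRecs2_t (by omega) (by omega) (by omega) (by omega), List.length_map]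
  rw [blockRecs2_t (by omega) (by omega) (by omega) (by omega), blockRecs2_a (by omega) (by omega) (by omega) (by omega), hlen] at hk
  have hf := fib_nonneg_of_check (twoCopyCheck_of_kronCheck hk) hz ht hzt
  rwa [fib_congr (fun c1 c2 hc1 hc2 => pairing_eq_Gm2 K j (am := am) (bm := bm) (by omega) (by omega) (by omega) (by omega) hc1 hc2)
    hz ht] at hf

/-- **`SunFAR K j` from a mask-level certificate by the SHARDED shared Kronecker check** (`K ≥ 2`). [this work] -/
theorem sunFAR_of_kronL2 (hK : 2 ≤ K) (am : ℕ → ℕ → ℕ → ℕ → ℕ) (bm : ℕ → ℕ → ℕ → ℕ) {s : ℕ}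
    (hN : checkN K j am = true) (hL : ∀ l, l < K + 2 → kronL2 K s (mkSBanks K j s (mkNTabs K am bm)) l = true) : SunFAR K j :=
  sunFAR_of_fib hK am bm hN (fib_nonneg_of_kronL2 hL)

/-- **`SunFAR K j` from a mask-level certificate by the shared Kronecker check** (`K ≥ 2`). [this work] -/
theorem sunFAR_of_kron2 (hK : 2 ≤ K) (am : ℕ → ℕ → ℕ → ℕ → ℕ) (bm : ℕ → ℕ → ℕ → ℕ) {s : ℕ}
    (hN : checkN K j am = true) (hC : kronAll2 K j s am bm = true) : SunFAR K j := by
  refine sunFAR_of_kronL2 (s := s) hK am bm hN fun l hl => ?_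
  unfold kronAll2 at hC
  simp only [List.all_eq_true, List.mem_range] at hC
  exact hC l hl


/-! ## Prefix length `K+1` duplicates prefix length `K` -/

/-- `cov K (K+1) l' = cov K K l'` (both are everything below `K`). [this work] -/
theorem cov_succ_self (K l' : ℕ) : cov K (K + 1) l' = cov K K l' := by
  unfold cov
  exact Finset.filter_congr fun k hk => by rw [mem_range] at hk; constructor <;> intro _ <;> left <;> omega

/-- `covM K (K+1) l' = covM K K l'`. [this work] -/
theorem covM_succ_self (K l' : ℕ) : covM K (K + 1) l' = covM K K l' := by
  unfold covM; rw [cov_succ_self]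

/-- `covM K K l'` is the full mask. [this work] -/
theorem covM_self (K l' : ℕ) : covM K K l' = 2 ^ K - 1 := by
  have hc : cov K K l' = range K := Finset.filter_true_of_mem fun k hk => Or.inl (mem_range.1 hk)
  unfold covM
  rw [hc]
  refine Nat.eq_of_testBit_eq fun i => ?_
  rw [testBit_enc, Nat.testBit_two_pow_sub_one]
  simp only [mem_range]

/-- A certificate reader that does not distinguish the ghost prefix lengths `K` and `K+1`. [this work] -/
structure PrefixInv (K : ℕ) (am : ℕ → ℕ → ℕ → ℕ → ℕ) (bm : ℕ → ℕ → ℕ → ℕ) : Prop where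
  /-- `a` -/
  ha : ∀ k q m', am k q (K + 1) m' = am k q K m'
  /-- `b` -/
  hb : ∀ q m', bm q (K + 1) m' = bm q K m'

/-- The typed reader `cyA532 / cyB532` is prefix-invariant. [this work] -/
theorem prefixInv_cy532 (K : ℕ) (tA tB : Array ℕ) : PrefixInv K (cyA532 K tA) (cyB532 K tB) := by
  constructor
  · intro k q m'
    unfold cyA532
    simp only [covM_succ_self, covM_self, beq_self_eq_true, ite_true]
  · intro q m'
    unfold cyB532
    simp only [covM_succ_self]

/-- The reached-set-level reader `rlA / rlB` is prefix-invariant. [this work] -/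
theorem prefixInv_rl (K : ℕ) (tA tB : Array ℕ) : PrefixInv K (rlA K tA) (rlB K tB) := by
  constructor
  · intro k q m'; unfold rlA; rw [covM_succ_self]
  · intro q m'; unfold rlB; rw [covM_succ_self]

/-- For a prefix-invariant reader the blocks with `l = K+1` are blocks with `l = K`. [this work] -/
theorem Gm_succ_self (hI : PrefixInv K am bm) (j m u v : ℕ) :
    Gm K j am bm (K + 1) m u v = Gm K j am bm K m u v ∧ Gm K j am bm (K + 1) (K + 1) u v = Gm K j am bm K K u v := by
  have e : ∀ r q u', Fm K j am bm r q (K + 1) u' = Fm K j am bm r q K u' := fun r q u' => by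
    unfold Fm; simp only [hI.ha, hI.hb]
  constructor <;> (funext c1 c2; unfold Gm; simp only [covM_succ_self, e])

/-- **Soundness with the `l ≤ K` shards only**, for prefix-invariant readers. [this work] -/
theorem fib_nonneg_of_kronL2' (hI : PrefixInv K am bm) (h : ∀ l, l ≤ K → kronL2 K s (mkSBanks K j s (mkNTabs K am bm)) l = true) :
    ∀ l m u v : ℕ, m ≤ l → l ≤ K + 1 → u ≤ v → v ≤ K →
      ∀ z t : ℕ, z < 2 ^ K → t < 2 ^ K → z &&& t = 0 → 0 ≤ fib K (Gm K j am bm l m u v) z t := by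
  -- the `l ≤ K` blocks, verbatim from `fib_nonneg_of_kronL2`
  have main : ∀ l m u v : ℕ, m ≤ l → l ≤ K → u ≤ v → v ≤ K →
      ∀ z t : ℕ, z < 2 ^ K → t < 2 ^ K → z &&& t = 0 → 0 ≤ fib K (Gm K j am bm l m u v) z t := by
    intro l m u v hml hl huv hv z t hz ht hzt
    have h1 := h l hl
    unfold kronL2 at h1
    simp only [List.all_eq_true, List.mem_range] at h1
    have hb := h1 m (by omega) v (by omega) u (by omega)
    have hk := kronCheck_of_kronPreP (blockRecs2_ok (j := j) (s := s) (by omega) (by omega) (by omega) (by omega) (mkNTabs K am bm)) hb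
    have hlen : (blockRecs2 K s (mkSBanks K j s (mkNTabs K am bm)) (mkPKl K (mkSBanks K j s (mkNTabs K am bm)) l)
        (mkPKm K (mkSBanks K j s (mkNTabs K am bm)) m) l m u v).length = (blockTerms2 K j (mkNTabs K am bm) l m u v).length := by
      rw [← List.length_map (f := fun r : PRec => r.t.tab), blockRecs2_t (by omega) (by omega) (by omega) (by omega), List.length_map]
    rw [blockRecs2_t (by omega) (by omega) (by omega) (by omega), blockRecs2_a (by omega) (by omega) (by omega) (by omega), hlen] at hk
    have hf := fib_nonneg_of_check (twoCopyCheck_of_kronCheck hk) hz ht hzt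
    rwa [fib_congr (fun c1 c2 hc1 hc2 => pairing_eq_Gm2 K j (am := am) (bm := bm) (by omega) (by omega) (by omega) (by omega) hc1 hc2)
      hz ht] at hf
  intro l m u v hml hl huv hv z t hz ht hzt
  rcases Nat.lt_or_ge l (K + 1) with hlK | hlK
  · exact main l m u v hml (by omega) huv hv z t hz ht hzt
  · obtain rfl : l = K + 1 := le_antisymm hl hlK
    rcases Nat.lt_or_ge m (K + 1) with hmK | hmK
    · rw [(Gm_succ_self hI j m u v).1]
      exact main K m u v (by omega) le_rfl huv hv z t hz ht hzt
    · obtain rfl : m = K + 1 := le_antisymm hml hmK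
      rw [(Gm_succ_self hI j 0 u v).2]
      exact main K K u v le_rfl le_rfl huv hv z t hz ht hzt

/-- **`SunFAR K j` from the `l ≤ K` shards of the shared Kronecker check**, for prefix-invariant readers (`K ≥ 2`). [this work] -/
theorem sunFAR_of_kronL2' (hK : 2 ≤ K) (am : ℕ → ℕ → ℕ → ℕ → ℕ) (bm : ℕ → ℕ → ℕ → ℕ) {s : ℕ} (hI : PrefixInv K am bm)
    (hN : checkN K j am = true) (hL : ∀ l, l ≤ K → kronL2 K s (mkSBanks K j s (mkNTabs K am bm)) l = true) : SunFAR K j :=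
  sunFAR_of_fib hK am bm hN (fib_nonneg_of_kronL2' hI hL)

end TK

end Summit.CriticalPhenomena.PercolationContinuityZ3.Theorems.HairyCycle
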